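import Literature.MathematicalPhysics.QuantumFieldTheory.Balaban1983to89.B9Ineq361L2Letters
import Literature.MathematicalPhysics.QuantumFieldTheory.Balaban1983to89.B9Ineq366CPrime
import Literature.MathematicalPhysics.QuantumFieldTheory.Balaban1983to89.B6RandomWalkL2Chain

/-!
# `Balaban1983to89.B9Ineq363L2` — [Balaban1985BackgroundPropagators] (3.63)–(3.65) p. 402 IN THE BLOCK-`ℓ²` CURRENCY OF (3.46): the `L²` (3.63)
# `V′(A)G′(U) ≺₂ O(1)B₀α₁e^{−ρd}` for the concrete `V′(A)` of (3.60) from Theorem 3.1's `L²` members (3.46)₀,₁ at U, and the LEFT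
# (3.46)-entries of `G′(U′U)` by the `ℓ²`-summed walk (3.64) (`B6RandomWalkL2Chain`) — brick 3 of the kernel-free route to the `L²`
# steps of Sect. B displayed in `B9SectBStepFrameV2.SectBFrame₂`

T. Bałaban, *Propagators for lattice gauge theories in a background field*, Commun. Math. Phys. **99** (1985) 389–434
[`Balaban1985BackgroundPropagators`, "B9"]; [4] = T. Bałaban, *Propagators and renormalization transformations for lattice gauge theories. II*,
Commun. Math. Phys. **96** (1984) 223–250 [`Balaban1984PropagatorsII`].

statement-level skeleton of published theorems with citation tags; proofs where landed; nothing here is a claim about the Yang–Mills mass gap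

THE PRINTED LOCUS (verbatim).  p. 402: *"the operator V′(A)G′(U) satisfies the bound |(V′(A)G′(U)λ)(x)| ≤ O(1)B₀α₁e^{−δ₀d(y,y′)} (3.63) for
x ∈ Δ(y), supp λ ⊂ Δ(y′). Thus for α₁ sufficiently small the norm of this operator is small and I − V′(A)G′(U) is an invertible operator, the
inverse is given by a convergent Neumann series. This implies the existence of the operator G′(U′U) and the equality
G′(U′U) = G′(U)(I − V′(A)G′(U))⁻¹ = Σ_{n=0}^∞ G′(U)(V′(A)G′(U))ⁿ (3.64) … G′(U′U) = G′(U) + G′(U′U)V′(A)G′(U) (3.65)"*; p. 403 l. 1–9: *"applying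
Theorem 3.1 for G′(U), the bound (3.63), the representation (3.64) and Lemma 2.1 of [4] we can prove all the statements (3.42)–(3.47) of
Theorem 3.1 for the operator G′(U′U), of course with different constants"*; (3.46) p. 398 (the `L²` members); [4] p. 247: *"the series above is
convergent in the norms appearing in the inequalities (2.136)–(2.140)"*.

WHY THIS FILE (pub-ymgap N06 row 13).  The capstone `B9SectBStepFrameV2.SectBFrame₂` DISPLAYS the (3.46) members of `G′(U′U)` and `G(U′U)` as
positive-input steps because the tree's only route to them (`B9Ineq346L2Final`) consumes Theorem 3.1 in the unprinted KERNEL form, vacuous at the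
genuine multiscale geometry (lit-balaban desk ME #13).  Print's own route is the walk (3.64) summed «in the norms appearing in the inequalities»
— for the `L²` members: the block-`ℓ²` calculus `B6RandomWalkL2` ∕ `…L2Chain` (seat p22) fed with (3.46) AT U and the `ℓ²` sizes of the local
letters of `V′(A)` (`B9Ineq361L2Letters`, this seat).  THIS FILE is the `L²` twin of r06's sup chain `B9Ineq366CPrime` §2 → `B9Ineq386CommSum.
ineq385_op_sum` → `B9Ineq363Vprime.ineq363_op_vPrime` → `B9Eq360Vprime.eq365_end` ∕ `B9Thm34Ext` (left entries of the extension), with the SAME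
letters and the same non-propagator hypotheses; the propagator inputs are Theorem 3.1's `L²` members (3.46)₀,₁ at U as `HasL2Majorant`s.

WHAT IS PROVED (0 sorry, 0 new named facts; standard axioms; one explicit-constant `def cVL2`).
* §1 `hasL2Majorant_finsetSum` ∕ `hasL2Majorant_sum_const` ∕ `hasL2Majorant_rate_mono`, ★ `hasL2Majorant_comp_decay` — composition of two
  decaying block-`ℓ²` majorants `A₁w₁e^{−rd}`, `A₂w₂e^{−ρd}` (`r ≧ ρ + (α+β)δ₀`) ⟹ `A₁A₂Cc₁(β)w₁w₂e^{−ρd}`: `B6RandomWalkL2.hasL2Majorant_mul` (no volume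
  factor in `ℓ²`) + r06's PURE KERNEL y″-sum `B9Ineq366CPrime.conv_le` BY NAME (scale transfer at `α`, (2.61) at `β`, (2.54)).
* §2 ★ `ineq363_op_sum_l2` — (3.63) in block-`ℓ²` form for a first-order operator in finite-sum gradient form `V = V⁰ + Σ_k V¹_k∇_k`:
  `V·G′ ≺₂ (2B₀Λc₁(β)c_V)·α₁·e^{−ρd}` from `V⁰ ≺₂ c_Vα₁ℓ⁻²e^{−δd}`, `V¹_k ≺₂ c_kα₁ℓ⁻¹e^{−δd}` (`Σc_k ≦ c_V`), (3.46)₀ `G′ ≺₂ B₀ℓ²e^{−δd}`,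
  (3.46)₁ `∇_kG′ ≺₂ B₀ℓe^{−δd}` (twin of `ineq385_op_sum` with `P₁ = P₂ = 0`).
* §3 `cVL2` (the explicit `c_V` of the concrete letters in `ℓ²`), ★★ `ineq363_l2_vPrime` — **THE `L²` (3.63) FOR THE CONCRETE `V′(A)` OF (3.60)**:
  `conj b (vPrimeConc …) · G′(U) ≺₂ (2B₀Λc₁(β)·cVL2)·α₁·e^{−ρd}` from (3.46)₀,₁ at U (`HasL2Majorant Gp (B₀ℓ²e^{−δd})`, `HasL2Majorant (∇_kGp)
  (B₀ℓe^{−δd})`) and the letters' `ℓ²` sizes of `B9Ineq361L2Letters` (`hasL2Majorant_V0_vPrime`, `hasL2Majorant_coefLetter`) along r06's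
  `conj_vPrimeConc_eq_gradForm` — twin of `B9Ineq363Vprime.ineq363_op_vPrime`.
* §4 `eq365_of_inverse` ((3.65) `G′(U′U) = G′(U) + G′(U′U)(V′(A)G′(U))` is ALGEBRA from `Δ′G′(U) = 1` and `G′(U′U)(Δ′ − V′) = 1` — no norm
  condition), ★★ `hasL2Majorant_leftEntry_gpExt` — **THE LEFT (3.46)-ENTRIES OF `G′(U′U)`**: `X·G′(U) ≺₂ A·P·e^{−δ₀d}`, `V′G′(U) ≺₂ θe^{−δ₀d}`, (3.65),
  [4] Lemma 2.1 at `(δ₀, α)` and `θc₁(α) < 1` ⟹ `X·G′(U′U) ≺₂ Ac₁(1 − θc₁)⁻¹·P·e^{−(1−α)δ₀d}` (`B6RandomWalkL2Chain.l2Majorant_of_fixedPoint_266`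
  BY NAME) — with `X = 1` this is (3.46)₀ of `G′(U′U)`, with `X = ∇_k` (3.46)₁, «of course with different constants».

WHAT IS NOT HERE (successor items).  (i) the RIGHT entries `G′(U′U)·Y` ((3.46)₂,₅; fixed point on the other side: `G′(U′U) = G′(U) +
G′(U)V′(A)G′(U′U)`, divergence form of `V′` as in r06's `gpExt_rightEntry_vPrime`); (ii) an `L2Frame₂` on the letters of `B9SectBGpStepAtLettersV2`
(readings (3.46)ₙ at U ↔ `HasL2Majorant` of the letters with the cut-off `h`, `B6RandomWalkL2.l2n_cut_apply_le_of_hasL2Majorant`; writing back) and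
the steps `stepL2nPos … Gp 0∕1` INHABITED from §3–§4 + r06's inverse identities (`thm34_Gp_uniform` (i)) — turning two of the displayed fields of
`SectBFrame₂` into frames; (iii) the G-twins (Theorem 3.3's operator; r06's `B9Ineq385VG`/`B9Thm34GFinal` chain in `ℓ²`).

HONEST SCOPE.  Finite-dimensional bookkeeping over r06's concrete letters; the propagator inputs ((3.46) at U, the inverse identities) are
hypotheses; nothing of [B9] is asserted for Bałaban's propagators; count-neutral; NOT a node discharge; nothing continuum ∕ OS ∕ mass-gap ∕ Clay.
Cell `pub-ymgap` (HUMAN RULING D-0062), Track A node N06 [B9], N06-ASSIGNMENT row 13 (the displayed `L²` steps), seat `pub-ymgap-dag-n06-c` (g4),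
2026-08-27.

RELATED IN THE TREE, NOT DUPLICATED: `B9Ineq366CPrime` (`conv_le` BY NAME; `hasMajorant_comp_decay` = the sup twin), `B9Ineq386CommSum.ineq385_op_sum`,
`B9Ineq363Vprime.ineq363_op_vPrime` (sup twins), `B9Eq360Vprime` (`gPrimeExtEnd`, `eq365_end` — the sup-norm (3.65); here (3.65) is taken from the
inverse identities), `B6RandomWalkL2` ∕ `B6RandomWalkL2Chain` (p22's `ℓ²` calculus, `l2Majorant_of_fixedPoint_266` BY NAME), `B9Ineq361L2Letters`
(this seat) — no existing module modified.
-/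

noncomputable section

open scoped BigOperators

namespace Literature.MathematicalPhysics.QuantumFieldTheory.Balaban1983to89.B9Ineq363L2

open Literature.MathematicalPhysics.QuantumFieldTheory.Balaban1983to89
open Literature.MathematicalPhysics.QuantumFieldTheory.Balaban1983to89.B6RandomWalk (Triangle254 Ineq261)
open Literature.MathematicalPhysics.QuantumFieldTheory.Balaban1983to89.B6RandomWalkL2 (l2n HasL2Majorant hasL2Majorant_mono
  hasL2Majorant_zero hasL2Majorant_add hasL2Majorant_mul)
open Literature.MathematicalPhysics.QuantumFieldTheory.Balaban1983to89.B9Thm34Ext (toB6)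
open Literature.MathematicalPhysics.QuantumFieldTheory.Balaban1983to89.B9Ineq347 (ScaleTransfer)
open Literature.MathematicalPhysics.QuantumFieldTheory.Balaban1983to89.B9Ineq366CPrime (conv_le)
open Literature.MathematicalPhysics.QuantumFieldTheory.Balaban1983to89.B9Eq352DivFormLetters (conj)
open Literature.MathematicalPhysics.QuantumFieldTheory.Balaban1983to89.B9Eq352DivForm (tauB)
open Literature.MathematicalPhysics.QuantumFieldTheory.Balaban1983to89.B9Eq352GradLetters (coefLetter diffLetter V0op)
open Literature.MathematicalPhysics.QuantumFieldTheory.Balaban1983to89.B9Eq360VprimeLetters (vPrimeConc conj_vPrimeConc_eq_gradForm)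
open Literature.MathematicalPhysics.QuantumFieldTheory.Balaban1983to89.B9Eq39Adjoint (covDstar)
open Literature.MathematicalPhysics.QuantumFieldTheory.Balaban1983to89.B9Ineq361L2Letters (hasL2Majorant_coefLetter
  hasL2Majorant_V0_vPrime)

/-! ## §1  Sums and compositions of decaying block-ℓ² majorants ([4] (2.52)–(2.55) in `L²`, the y″-sum by `conv_le`) -/

section Composition

variable {g : B9.Geometry} [Fintype g.Site] {R : ℝ} {H : Prop} {W : Type} [Fintype W] {K : Type}

/-- **«A summation preserves it also» in `L²`** over a finite index set. [cite: Balaban1984PropagatorsII, (2.52) p.232 + (2.141) p.247] -/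
theorem hasL2Majorant_finsetSum (blk : W → g.Site) (s : Finset K) (T : K → Module.End ℝ (W → ℝ))
    (Kf : K → g.Site → g.Site → ℝ) (h : ∀ k ∈ s, HasL2Majorant (g := toB6 g R H) blk (T k) (Kf k)) :
    HasL2Majorant (g := toB6 g R H) blk (∑ k ∈ s, T k) (fun a b => ∑ k ∈ s, Kf k a b) := by
  classical
  induction s using Finset.induction_on with
  | empty => simpa using hasL2Majorant_zero (g := toB6 g R H) blk
  | insert i s hi ih =>
      have h' := hasL2Majorant_add (g := toB6 g R H) blk (h i (Finset.mem_insert_self i s))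
        (ih fun k hk => h k (Finset.mem_insert_of_mem hk))
      intro y y' u hu
      simpa [Finset.sum_insert hi] using h' y y' u hu

/-- Sums with a common shape: `T_k ≺₂ c_k·w` ⟹ `Σ_{k∈s} T_k ≺₂ (Σ_k c_k)·w`. [cite: Balaban1984PropagatorsII, (2.52) p.232 + (2.141) p.247] -/
theorem hasL2Majorant_sum_const (blk : W → g.Site) (s : Finset K) (c : K → ℝ) (w : g.Site → g.Site → ℝ)
    {T : K → Module.End ℝ (W → ℝ)} (h : ∀ k ∈ s, HasL2Majorant (g := toB6 g R H) blk (T k) (fun a b => c k * w a b)) :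
    HasL2Majorant (g := toB6 g R H) blk (∑ k ∈ s, T k) (fun a b => (∑ k ∈ s, c k) * w a b) := by
  refine hasL2Majorant_mono (g := toB6 g R H) blk
    (hasL2Majorant_finsetSum (R := R) (H := H) blk s T (fun k a b => c k * w a b) h) fun a b => le_of_eq ?_
  rw [Finset.sum_mul]

/-- Rate monotonicity of the exponential weight: `ρ ≦ r`, `t ≧ 0` ⟹ `e^{−rt} ≦ e^{−ρt}`. [folklore] -/
private theorem exp_rate_mono {ρ r t : ℝ} (h : ρ ≤ r) (ht : 0 ≤ t) : Real.exp (-(r * t)) ≤ Real.exp (-(ρ * t)) :=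
  Real.exp_le_exp.mpr (by nlinarith)

/-- Weakening the rate of an ℓ² majorant `A·w(y)·e^{−r d(y,y′)}` to `ρ ≦ r`. [cite: Balaban1984PropagatorsII, (2.140) p.247 (bookkeeping, ours)] -/
theorem hasL2Majorant_rate_mono (blk : W → g.Site) {T : Module.End ℝ (W → ℝ)} (A : ℝ) (w : g.Site → ℝ) {ρ r : ℝ}
    (hA : 0 ≤ A) (hw : ∀ a, 0 ≤ w a) (hρr : ρ ≤ r) (hdnn : ∀ a b : g.Site, 0 ≤ g.dist a b)
    (h : HasL2Majorant (g := toB6 g R H) blk T (fun a b => A * w a * Real.exp (-(r * g.dist a b)))) :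
    HasL2Majorant (g := toB6 g R H) blk T (fun a b => A * w a * Real.exp (-(ρ * g.dist a b))) :=
  hasL2Majorant_mono (g := toB6 g R H) blk h fun a b =>
    mul_le_mul_of_nonneg_left (exp_rate_mono hρr (hdnn a b)) (mul_nonneg hA (hw a))

/-- **COMPOSITION OF TWO DECAYING BLOCK-ℓ² MAJORANTS** (the `L²` twin of `B9Ineq366CPrime.hasMajorant_comp_decay`): `T₁ ≺₂ A₁w₁(y)e^{−r d}`
(`r ≧ ρ + (α+β)δ₀`), `T₂ ≺₂ A₂w₂(y)e^{−ρ d}`, the scale transfer at `α` with constant `C` for `w₂`, (2.61) at `β` and (2.54) give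
`T₁T₂ ≺₂ A₁A₂Cc₁(β)·w₁(y)w₂(y)·e^{−ρ d(y,y′)}` — `hasL2Majorant_mul` (no volume factor in `L²`) + the y″-sum `conv_le`.
[cite: Balaban1984PropagatorsII, (2.52)–(2.55) p.232 + (2.68) p.235 + Prop. 2.6 (2.140)–(2.141) p.247; Balaban1985BackgroundPropagators, (3.66) p.403] -/
theorem hasL2Majorant_comp_decay (blk : W → g.Site) (d : ℕ) (δ₀ α β ρ r C A₁ A₂ : ℝ) (w₁ w₂ : g.Site → ℝ)
    (hw₁ : ∀ a, 0 ≤ w₁ a) (hw₂ : ∀ a, 0 ≤ w₂ a) (hC : 0 ≤ C) (hA₁ : 0 ≤ A₁) (hA₂ : 0 ≤ A₂) (hρ : 0 ≤ ρ)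
    (hr : ρ + (α + β) * δ₀ ≤ r) (hdnn : ∀ a b : g.Site, 0 ≤ g.dist a b)
    (htri : Triangle254 (toB6 g R H)) (hST : ScaleTransfer g δ₀ α C w₂)
    (h261 : Ineq261 d (toB6 g R H) δ₀ β) {T₁ T₂ : Module.End ℝ (W → ℝ)}
    (h₁ : HasL2Majorant (g := toB6 g R H) blk T₁ (fun a b => A₁ * w₁ a * Real.exp (-(r * g.dist a b))))
    (h₂ : HasL2Majorant (g := toB6 g R H) blk T₂ (fun a b => A₂ * w₂ a * Real.exp (-(ρ * g.dist a b)))) :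
    HasL2Majorant (g := toB6 g R H) blk (T₁ * T₂)
      (fun a b => (A₁ * A₂ * C * B6.c1 d δ₀ β) * (w₁ a * w₂ a) * Real.exp (-(ρ * g.dist a b))) := by
  have hK₁ : ∀ a b : g.Site, 0 ≤ A₁ * w₁ a * Real.exp (-(r * g.dist a b)) := fun a b =>
    mul_nonneg (mul_nonneg hA₁ (hw₁ a)) (Real.exp_nonneg _)
  refine hasL2Majorant_mono (g := toB6 g R H) blk (hasL2Majorant_mul (g := toB6 g R H) blk h₁ h₂ hK₁) fun a b => ?_
  have hc := conv_le (R := R) (H := H) d δ₀ α β ρ r C w₁ w₂ hw₁ hw₂ hC hρ hr hdnn htri hST h261 a b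
  calc ∑ c : g.Site, A₁ * w₁ a * Real.exp (-(r * g.dist a c)) * (A₂ * w₂ c * Real.exp (-(ρ * g.dist c b)))
      = (A₁ * A₂) * ∑ c : g.Site, (w₁ a * Real.exp (-(r * g.dist a c))) * (w₂ c * Real.exp (-(ρ * g.dist c b))) := by
        rw [Finset.mul_sum]
        exact Finset.sum_congr rfl fun c _ => by ring
    _ ≤ (A₁ * A₂) * (C * B6.c1 d δ₀ β * (w₁ a * w₂ a) * Real.exp (-(ρ * g.dist a b))) :=
        mul_le_mul_of_nonneg_left hc (mul_nonneg hA₁ hA₂)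
    _ = (A₁ * A₂ * C * B6.c1 d δ₀ β) * (w₁ a * w₂ a) * Real.exp (-(ρ * g.dist a b)) := by ring

end Composition

/-! ## §2  (3.63) in block-ℓ² form for a first-order operator in finite-sum gradient form -/

section Abstract

variable {g : B9.Geometry} [Fintype g.Site] {R : ℝ} {H : Prop} {W : Type} [Fintype W] {K : Type}

/-- **(3.63) IN THE BLOCK-ℓ² FORM OF [4] (2.140), for a first-order operator in finite-sum gradient form** (the `L²` twin of
`B9Ineq363Vprime.ineq363_op_sum`): with `V = V⁰ + Σ_{k∈s} V¹_k∇_k`, `V⁰ ≺₂ c_Vα₁(Lʲη)⁻²e^{−δd}`, `V¹_k ≺₂ c_kα₁(Lʲη)⁻¹e^{−δd}` (`Σ_kc_k ≦ c_V`),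
Theorem 3.1 for `G′(U)` in its `L²` form (3.46)₀ `G′ ≺₂ B₀(Lʲη)²e^{−δd}` and (3.46)₁ `∇_kG′ ≺₂ B₀Lʲη e^{−δd}` per difference letter, the scale
transfers of `Lʲη`, `(Lʲη)²` at exponent `α` (constant `Λ`), (2.61) at `β` and (2.54): `V·G′ ≺₂ (2B₀Λc₁(β)c_V)·α₁·e^{−ρd(y,y′)}` for `ρ ≧ 0`,
`ρ + (α+β)δ₀ ≦ δ`. [cite: Balaban1985BackgroundPropagators, (3.61)–(3.63) p.402 + (3.46) p.398; Balaban1984PropagatorsII, Lemma 2.1 p.234 + Prop. 2.6 (2.140)–(2.141) p.247] -/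
theorem ineq363_op_sum_l2 (blk : W → g.Site) (d : ℕ) (s : Finset K) (δ₀ δ α β ρ Λ B₀ cV α₁ : ℝ) (c1 : K → ℝ)
    (hB₀ : 0 ≤ B₀) (hcV : 0 ≤ cV) (hα₁ : 0 ≤ α₁) (hΛ : 0 ≤ Λ) (hρ : 0 ≤ ρ) (hα : 0 ≤ α) (hβ : 0 ≤ β) (hδ₀ : 0 ≤ δ₀)
    (hr : ρ + (α + β) * δ₀ ≤ δ) (hc1 : ∀ k ∈ s, 0 ≤ c1 k) (hsum : ∑ k ∈ s, c1 k ≤ cV)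
    (hdnn : ∀ a b : g.Site, 0 ≤ g.dist a b) (htri : Triangle254 (toB6 g R H)) (hlen : ∀ y : g.Site, 0 < g.len y)
    (h261 : Ineq261 d (toB6 g R H) δ₀ β)
    (hT1 : ScaleTransfer g δ₀ α Λ (fun a => g.len a)) (hT2 : ScaleTransfer g δ₀ α Λ (fun a => g.len a ^ 2))
    {G V V0 : Module.End ℝ (W → ℝ)} {V1 D : K → Module.End ℝ (W → ℝ)} (hVg : V = V0 + ∑ k ∈ s, V1 k * D k)
    (hV0 : HasL2Majorant (g := toB6 g R H) blk V0
      (fun a b => cV * α₁ * (g.len a ^ 2)⁻¹ * Real.exp (-(δ * g.dist a b))))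
    (hV1 : ∀ k ∈ s, HasL2Majorant (g := toB6 g R H) blk (V1 k)
      (fun a b => c1 k * α₁ * (g.len a)⁻¹ * Real.exp (-(δ * g.dist a b))))
    (hG : HasL2Majorant (g := toB6 g R H) blk G (fun a b => B₀ * g.len a ^ 2 * Real.exp (-(δ * g.dist a b))))
    (hDG : ∀ k ∈ s, HasL2Majorant (g := toB6 g R H) blk (D k * G)
      (fun a b => B₀ * g.len a * Real.exp (-(δ * g.dist a b)))) :
    HasL2Majorant (g := toB6 g R H) blk (V * G)
      (fun a b => (2 * B₀ * Λ * B6.c1 d δ₀ β * cV) * α₁ * Real.exp (-(ρ * g.dist a b))) := by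
  set c : ℝ := B6.c1 d δ₀ β with hc_def
  have hc0 : 0 ≤ c := B6RandomWalk.c1_nonneg d δ₀ β
  have hw1 : ∀ a : g.Site, 0 ≤ g.len a := fun a => (hlen a).le
  have hw2 : ∀ a : g.Site, 0 ≤ g.len a ^ 2 := fun a => sq_nonneg _
  have hw1i : ∀ a : g.Site, 0 ≤ (g.len a)⁻¹ := fun a => inv_nonneg.mpr (hlen a).le
  have hw2i : ∀ a : g.Site, 0 ≤ (g.len a ^ 2)⁻¹ := fun a => inv_nonneg.mpr (sq_nonneg _)
  have hcVα : 0 ≤ cV * α₁ := mul_nonneg hcV hα₁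
  have hρδ : ρ ≤ δ := by
    have : 0 ≤ (α + β) * δ₀ := by positivity
    linarith
  -- the word V⁰G′
  have hGρ := hasL2Majorant_rate_mono (R := R) (H := H) blk B₀ (fun a => g.len a ^ 2) hB₀ hw2 hρδ hdnn hG
  have w1 := hasL2Majorant_comp_decay (R := R) (H := H) blk d δ₀ α β ρ δ Λ (cV * α₁) B₀ (fun a => (g.len a ^ 2)⁻¹)
    (fun a => g.len a ^ 2) hw2i hw2 hΛ hcVα hB₀ hρ hr hdnn htri hT2 h261 hV0 hGρ
  -- the words V¹_k(∇_kG′), summed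
  have w2k : ∀ k ∈ s, HasL2Majorant (g := toB6 g R H) blk (V1 k * (D k * G))
      (fun a b => (c1 k * α₁ * B₀ * Λ * c) * (((g.len a)⁻¹ * g.len a) * Real.exp (-(ρ * g.dist a b)))) := by
    intro k hk
    have hDGρ := hasL2Majorant_rate_mono (R := R) (H := H) blk B₀ (fun a => g.len a) hB₀ hw1 hρδ hdnn (hDG k hk)
    have h := hasL2Majorant_comp_decay (R := R) (H := H) blk d δ₀ α β ρ δ Λ (c1 k * α₁) B₀ (fun a => (g.len a)⁻¹)
      (fun a => g.len a) hw1i hw1 hΛ (mul_nonneg (hc1 k hk) hα₁) hB₀ hρ hr hdnn htri hT1 h261 (hV1 k hk) hDGρ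
    exact hasL2Majorant_mono (g := toB6 g R H) blk h fun a b => le_of_eq (by rw [← hc_def]; ring)
  have w2 := hasL2Majorant_sum_const (R := R) (H := H) blk s (fun k => c1 k * α₁ * B₀ * Λ * c)
    (fun a b => ((g.len a)⁻¹ * g.len a) * Real.exp (-(ρ * g.dist a b))) w2k
  have hsum' := hasL2Majorant_add (g := toB6 g R H) blk w1 w2
  have e : V * G = V0 * G + ∑ k ∈ s, V1 k * (D k * G) := by
    rw [hVg]
    simp only [add_mul, Finset.sum_mul, mul_assoc]
  rw [e]
  refine hasL2Majorant_mono (g := toB6 g R H) blk hsum' fun a b => ?_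
  have ha : g.len a ≠ 0 := (hlen a).ne'
  have h1 : (g.len a)⁻¹ * g.len a = 1 := inv_mul_cancel₀ ha
  have h2 : (g.len a ^ 2)⁻¹ * g.len a ^ 2 = 1 := inv_mul_cancel₀ (pow_ne_zero 2 ha)
  have hS : (∑ k ∈ s, c1 k * α₁ * B₀ * Λ * c) ≤ cV * α₁ * B₀ * Λ * c := by
    rw [← Finset.sum_mul, ← Finset.sum_mul, ← Finset.sum_mul, ← Finset.sum_mul]
    have : 0 ≤ α₁ * B₀ * Λ * c := by positivity
    have := mul_le_mul_of_nonneg_right hsum this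
    nlinarith
  have hE : 0 ≤ Real.exp (-(ρ * g.dist a b)) := Real.exp_nonneg _
  rw [h1, h2] at *
  nlinarith [mul_le_mul_of_nonneg_right hS hE]

end Abstract

/-! ## §3  (3.63) in block-ℓ² form for the CONCRETE `V′(A)` of (3.60) -/

section Concrete

variable {𝔸 : Type*} [NormedRing 𝔸] [NormedAlgebra ℂ 𝔸] [CompleteSpace 𝔸] {ι : Type} [Fintype ι] [DecidableEq ι]
variable (b : Module.Basis ι ℝ 𝔸) {S : Type} [Fintype S] [DecidableEq S] {κ : Type} [Fintype κ]
variable (T : κ → Equiv.Perm S) (U : κ → S → 𝔸ˣ)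
variable {g : B9.Geometry} [Fintype g.Site] [DecidableEq g.Site] {Rr : ℝ} {H : Prop}

/-- The `L²` zeroth-order constant of the concrete `V′(A)` after coordinates (`B9Ineq361L2Letters.hasL2Majorant_V0_vPrime`) PLUS the summed
coefficient constant `2|κ|·2M₂(Σ‖b‖)√#ι·e^{δd₀}` (`hasL2Majorant_coefLetter` over `κ ⊕ κ`): the `c_V` of §2 for the concrete letters.
[cite: Balaban1985BackgroundPropagators, (3.61) p.402 + (3.46) p.398] -/
def cVL2 (d nι : ℕ) (ρu α₁ a₀ C M₂ Sb Sb2 E₀ : ℝ) : ℝ :=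
  (((2 + 8 * ρu ^ 2 * α₁) * d * M₂ * Sb * Real.sqrt (((2 * d + 1) * nι : ℕ) : ℝ) +
      a₀ * C * (2 + C * α₁) * M₂ * Real.sqrt nι * Sb2) * E₀) +
    2 * d * (2 * M₂ * Sb * Real.sqrt ((1 * nι : ℕ) : ℝ) * E₀)

omit [Fintype ι] [DecidableEq ι] [Fintype S] [DecidableEq S] [Fintype κ] [Fintype g.Site] [DecidableEq g.Site] in
/-- `0 ≦ cVL2`. [cite: Balaban1985BackgroundPropagators, (3.61) p.402 (bookkeeping, ours)] -/
theorem cVL2_nonneg {d nι : ℕ} {ρu α₁ a₀ C M₂ Sb Sb2 E₀ : ℝ} (hα₁ : 0 ≤ α₁) (ha₀ : 0 ≤ a₀) (hC : 0 ≤ C) (hM₂ : 0 ≤ M₂)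
    (hSb : 0 ≤ Sb) (hSb2 : 0 ≤ Sb2) (hE₀ : 0 ≤ E₀) : 0 ≤ cVL2 d nι ρu α₁ a₀ C M₂ Sb Sb2 E₀ := by
  unfold cVL2; positivity

/-- ★ **THE `L²` (3.63) FOR THE CONCRETE `V′(A)` OF (3.60)** — «the operator V′(A)G′(U) satisfies the bound |(V′(A)G′(U)λ)(x)| ≦ O(1)B₀α₁e^{−δ₀d(y,y′)}
(3.63)», read in the `L²` norms of (3.46) («we can prove all the statements (3.42)–(3.47) … for the operator G′(U′U)», p. 403; [4] p. 247 «the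
series is convergent in the norms appearing in (2.136)–(2.140)»): after real coordinates `conj b V′(A) · G′(U) ≺₂ θ·e^{−ρd}`,
`θ = 2B₀Λc₁(β)·cVL2·α₁` EXPLICIT.  INPUTS: (3.37) read blockwise for the letters of `V′₁(A)`, transports `≦ ρu`, `ηα₁ℓ⁻¹ ≦ 1/4`, the stencil
geometry, the (3.19)/(3.58)/(3.24) bounds of the averaging letters (with print's volume factor `#Δ(y)·w(y) ≦ 1`), the coordinate bound `M₂`;
THEOREM 3.1 FOR `G′(U)` IN ITS `L²` FORM: (3.46)₀ `G′ ≺₂ B₀(Lʲη)²e^{−δd}` and (3.46)₁ `∇_kG′ ≺₂ B₀Lʲη e^{−δd}` for each concrete difference letter;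
Lemma 2.1 of [4] (scale transfers at `α`, (2.61) at `β`, (2.54)).  The `L²` twin of `B9Ineq363Vprime.ineq363_op_vPrime`, same letters, same
non-propagator hypotheses. [cite: Balaban1985BackgroundPropagators, (3.63) p.402 + (3.60)–(3.61) p.402 + (3.46) p.398 + p.403 l.1–9; Balaban1984PropagatorsII, Lemma 2.1 p.234 + Prop. 2.6 (2.140)–(2.141) p.247] -/
theorem ineq363_l2_vPrime (blk : S → g.Site) (d : ℕ) {η : ℝ} (hη : 0 < η) (A : κ → S → 𝔸)
    (kQ kF : g.Site → S → 𝔸 →L[ℝ] 𝔸) (sQ sF : S → 𝔸 →L[ℝ] 𝔸) (c w : g.Site → ℝ) (ρu d₀ M₂ C a₀ : ℝ)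
    (δ₀ δ α β ρ Λ B₀ α₁ : ℝ)
    (hB₀ : 0 ≤ B₀) (hα₁ : 0 ≤ α₁) (hΛ : 0 ≤ Λ) (hρ : 0 ≤ ρ) (hα : 0 ≤ α) (hβ : 0 ≤ β) (hδ₀ : 0 ≤ δ₀) (hδ : 0 ≤ δ)
    (hr : ρ + (α + β) * δ₀ ≤ δ)
    (hdnn : ∀ a a' : g.Site, 0 ≤ g.dist a a') (htri : Triangle254 (toB6 g Rr H)) (hlen : ∀ y : g.Site, 0 < g.len y)
    (h261 : Ineq261 d (toB6 g Rr H) δ₀ β)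
    (hT1 : ScaleTransfer g δ₀ α Λ (fun a => g.len a)) (hT2 : ScaleTransfer g δ₀ α Λ (fun a => g.len a ^ 2))
    (hM₂ : 0 ≤ M₂) (hrepr : ∀ (v : 𝔸) (i : ι), |b.repr v i| ≤ M₂ * ‖v‖)
    (hsmall : ∀ y : g.Site, η * (α₁ * (g.len y)⁻¹) ≤ 1 / 4)
    (hA : ∀ μ x, ‖A μ x‖ ≤ α₁ * (g.len (blk x))⁻¹ ∧ ‖tauB T U μ (A μ) x‖ ≤ α₁ * (g.len (blk x))⁻¹)
    (h337s : ∀ μ x, ‖((η : ℂ)⁻¹) • covDstar T U μ (A μ) x‖ ≤ α₁ * (g.len (blk x) ^ 2)⁻¹)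
    (hρu : ∀ μ x, ‖((U μ x : 𝔸ˣ) : 𝔸)‖ ≤ ρu ∧ ‖(((U μ x)⁻¹ : 𝔸ˣ) : 𝔸)‖ ≤ ρu)
    (hd₀ : ∀ μ x, g.dist (blk x) (blk (T μ x)) ≤ d₀ ∧ g.dist (blk x) (blk ((T μ).symm x)) ≤ d₀)
    (hd₀0 : ∀ y : g.Site, g.dist y y ≤ d₀)
    (hw : ∀ y, 0 ≤ w y) (hcard : ∀ y, ((B9Eq360Vprime.block blk y).card : ℝ) * w y ≤ 1) (hC : 0 ≤ C) (ha₀ : 0 ≤ a₀)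
    (hkQ : ∀ y x, blk x = y → ‖kQ y x‖ ≤ w y) (hkF : ∀ y x, blk x = y → ‖kF y x‖ ≤ C * α₁ * w y)
    (hsQ : ∀ x, ‖sQ x‖ ≤ 1) (hsF : ∀ x, ‖sF x‖ ≤ C * α₁) (hc : ∀ y, |c y| ≤ a₀ * (g.len y ^ 2)⁻¹)
    {Gp : Module.End ℝ (S × ι → ℝ)}
    (h346_0 : HasL2Majorant (g := toB6 g Rr H) (fun p : S × ι => blk p.1) Gp
      (fun a a' => B₀ * g.len a ^ 2 * Real.exp (-(δ * g.dist a a'))))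
    (h346_1 : ∀ k : κ ⊕ κ, HasL2Majorant (g := toB6 g Rr H) (fun p : S × ι => blk p.1)
      (conj b (diffLetter T U ((η : ℂ)⁻¹) k) * Gp) (fun a a' => B₀ * g.len a * Real.exp (-(δ * g.dist a a')))) :
    HasL2Majorant (g := toB6 g Rr H) (fun p : S × ι => blk p.1)
      (conj b (vPrimeConc T U η A blk kQ kF sQ sF c) * Gp)
      (fun a a' => (2 * B₀ * Λ * B6.c1 d δ₀ β *
          cVL2 (Fintype.card κ) (Fintype.card ι) ρu α₁ a₀ C M₂ (∑ i, ‖b i‖) (Real.sqrt (∑ i, ‖b i‖ ^ 2)) (Real.exp (δ * d₀))) *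
        α₁ * Real.exp (-(ρ * g.dist a a'))) := by
  have hSb : 0 ≤ ∑ i, ‖b i‖ := Finset.sum_nonneg fun i _ => norm_nonneg _
  have hSb2 : 0 ≤ Real.sqrt (∑ i, ‖b i‖ ^ 2) := Real.sqrt_nonneg _
  have hE₀ : 0 ≤ Real.exp (δ * d₀) := Real.exp_nonneg _
  have hd : (0 : ℝ) ≤ Fintype.card κ := Nat.cast_nonneg _
  -- the zeroth-order constant and the summed coefficient constant
  set c0L : ℝ := ((2 + 8 * ρu ^ 2 * α₁) * Fintype.card κ * M₂ * (∑ i, ‖b i‖) *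
        Real.sqrt (((2 * Fintype.card κ + 1) * Fintype.card ι : ℕ) : ℝ) +
      a₀ * C * (2 + C * α₁) * M₂ * Real.sqrt (Fintype.card ι) * Real.sqrt (∑ i, ‖b i‖ ^ 2)) * Real.exp (δ * d₀) with hc0L
  set c1L : ℝ := 2 * M₂ * (∑ i, ‖b i‖) * Real.sqrt ((1 * Fintype.card ι : ℕ) : ℝ) * Real.exp (δ * d₀) with hc1L
  have hc0L0 : 0 ≤ c0L := by rw [hc0L]; positivity
  have hc1L0 : 0 ≤ c1L := by rw [hc1L]; positivity
  have hcV_eq : cVL2 (Fintype.card κ) (Fintype.card ι) ρu α₁ a₀ C M₂ (∑ i, ‖b i‖) (Real.sqrt (∑ i, ‖b i‖ ^ 2))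
      (Real.exp (δ * d₀)) = c0L + 2 * Fintype.card κ * c1L := by
    rw [cVL2, hc0L, hc1L]
  have hcV : 0 ≤ cVL2 (Fintype.card κ) (Fintype.card ι) ρu α₁ a₀ C M₂ (∑ i, ‖b i‖) (Real.sqrt (∑ i, ‖b i‖ ^ 2))
      (Real.exp (δ * d₀)) := cVL2_nonneg hα₁ ha₀ hC hM₂ hSb hSb2 hE₀
  -- `hV0` in L² at the larger constant `cVL2`
  have hV0 : HasL2Majorant (g := toB6 g Rr H) (fun p : S × ι => blk p.1)
      (conj b (V0op T U η A) - conj b (B9Eq360VprimeLetters.avgOp blk kQ kF sQ sF c))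
      (fun y y' => cVL2 (Fintype.card κ) (Fintype.card ι) ρu α₁ a₀ C M₂ (∑ i, ‖b i‖) (Real.sqrt (∑ i, ‖b i‖ ^ 2))
          (Real.exp (δ * d₀)) * α₁ * (g.len y ^ 2)⁻¹ * Real.exp (-(δ * g.dist y y'))) := by
    refine hasL2Majorant_mono (g := toB6 g Rr H) _
      (hasL2Majorant_V0_vPrime b T U blk hη A kQ kF sQ sF c w ρu d₀ δ M₂ α₁ C a₀ hα₁ hδ hM₂ hrepr hlen hsmall hA h337s hρu
        hd₀ hd₀0 hw hcard hC ha₀ hkQ hkF hsQ hsF hc) fun y y' => ?_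
    change g.Site at y y'
    have hw2 : 0 ≤ (g.len y ^ 2)⁻¹ := inv_nonneg.mpr (sq_nonneg _)
    have hε : 0 ≤ Real.exp (-(δ * g.dist y y')) := Real.exp_nonneg _
    have hle : c0L ≤ cVL2 (Fintype.card κ) (Fintype.card ι) ρu α₁ a₀ C M₂ (∑ i, ‖b i‖) (Real.sqrt (∑ i, ‖b i‖ ^ 2))
        (Real.exp (δ * d₀)) := by
      rw [hcV_eq]; nlinarith
    have : c0L * α₁ * (g.len y ^ 2)⁻¹ * Real.exp (-(δ * g.dist y y')) ≤
        cVL2 (Fintype.card κ) (Fintype.card ι) ρu α₁ a₀ C M₂ (∑ i, ‖b i‖) (Real.sqrt (∑ i, ‖b i‖ ^ 2)) (Real.exp (δ * d₀)) *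
          α₁ * (g.len y ^ 2)⁻¹ * Real.exp (-(δ * g.dist y y')) := by gcongr
    simpa only [hc0L] using this
  have h := ineq363_op_sum_l2 (R := Rr) (H := H) (fun p : S × ι => blk p.1) d (Finset.univ : Finset (κ ⊕ κ)) δ₀ δ α β ρ Λ B₀
    (cVL2 (Fintype.card κ) (Fintype.card ι) ρu α₁ a₀ C M₂ (∑ i, ‖b i‖) (Real.sqrt (∑ i, ‖b i‖ ^ 2)) (Real.exp (δ * d₀))) α₁
    (fun _ => c1L) hB₀ hcV hα₁ hΛ hρ hα hβ hδ₀ hr (fun _ _ => hc1L0) ?_ hdnn htri hlen h261 hT1 hT2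
    (V1 := fun k => conj b (coefLetter T U A k)) (D := fun k => conj b (diffLetter T U ((η : ℂ)⁻¹) k))
    (conj_vPrimeConc_eq_gradForm b T U η A blk kQ kF sQ sF c) hV0
    (fun k _ => by simpa only [hc1L] using hasL2Majorant_coefLetter b T U blk A d₀ δ M₂ α₁ hα₁ hδ hM₂ hrepr hlen hA hd₀0 k)
    h346_0 (fun k _ => h346_1 k)
  · exact h
  · rw [Finset.sum_const, Finset.card_univ, Fintype.card_sum, nsmul_eq_mul, Nat.cast_add, hcV_eq]
    have : ((Fintype.card κ : ℕ) : ℝ) + (Fintype.card κ : ℕ) = 2 * Fintype.card κ := by ring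
    rw [this]
    nlinarith

end Concrete

/-! ## §4  (3.65) from the inverse identities, and the LEFT (3.46)-entries of `G′(U′U)` by the ℓ²-summed walk (3.64) -/

section Extension

variable {g : B9.Geometry} [Fintype g.Site] {R : ℝ} {H : Prop} {W : Type} [Fintype W] [DecidableEq W]

omit [Fintype g.Site] [Fintype W] [DecidableEq W] in
/-- **(3.65) IS ALGEBRA once `G′(U′U)` inverts `Δ′_a(U) − V′(A)` and `G′(U)` inverts `Δ′_a(U)`**: `G′(U′U) = G′(U) + G′(U′U)·(V′(A)G′(U))`
(multiply `G′(U′U)(Δ′ − V′) = 1` on the right by `G′(U)` and use `Δ′G′(U) = 1`) — the fixed-point form the walk (3.64) is summed from, with no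
norm condition. [cite: Balaban1985BackgroundPropagators, (3.62)–(3.65) p.402] -/
theorem eq365_of_inverse {A : Type*} [Ring A] {Δp Vp GpU GpExt : A} (hΔG : Δp * GpU = 1) (hinv : GpExt * (Δp - Vp) = 1) :
    GpExt = GpU + GpExt * (Vp * GpU) := by
  have h : GpExt * (Δp - Vp) * GpU = GpU := by rw [hinv, one_mul]
  have h' : GpExt * (Δp - Vp) * GpU = GpExt * (Δp * GpU) - GpExt * (Vp * GpU) := by
    rw [mul_sub, sub_mul, mul_assoc, mul_assoc]
  rw [h', hΔG, mul_one] at h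
  -- h : GpExt - GpExt * (Vp * GpU) = GpU
  exact sub_eq_iff_eq_add.mp h

/-- ★ **THE LEFT (3.46)-ENTRIES OF `G′(U′U)` BY THE ℓ²-SUMMED WALK (3.64)** («the series is convergent in the norms appearing in the inequalities»,
[4] p. 247; [B9] p. 403 l. 1–9): if `X·G′(U) ≺₂ A·P(y)·e^{−δ₀d}` (an `L²` member of Theorem 3.1 at U for the left letter `X` — `X = 1`: (3.46)₀,
`X = ∇_k`: (3.46)₁), `V′(A)G′(U) ≺₂ θ·e^{−δ₀d}` (the `L²` (3.63), §3), `G′(U′U) = G′(U) + G′(U′U)·(V′(A)G′(U))` ((3.65), `eq365_of_inverse`), [4]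
Lemma 2.1 at `(δ₀, α)` with the smallness `θc₁(α) < 1`, then `X·G′(U′U) ≺₂ Ac₁(α)(1 − θc₁(α))⁻¹·P(y)·e^{−(1−α)δ₀d}` —
`B6RandomWalkL2Chain.l2Majorant_of_fixedPoint_266` BY NAME on the fixed point `X·G′(U′U) = X·G′(U) + (X·G′(U′U))·W`.
[cite: Balaban1985BackgroundPropagators, (3.64)–(3.65) p.402 + (3.46) p.398 + p.403 l.1–9; Balaban1984PropagatorsII, (2.66) p.234 + Prop. 2.6 (2.140)–(2.141) p.247 + Lemma 2.1 p.234] -/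
theorem hasL2Majorant_leftEntry_gpExt (blk : W → g.Site) (d : ℕ) (δ₀ α θ A : ℝ) (P : g.Site → ℝ)
    (hA : 0 ≤ A) (hP : ∀ y, 0 ≤ P y) (hθ : 0 ≤ θ) (hδ₀ : 0 ≤ δ₀) (hα : α ≤ 1)
    (htri : Triangle254 (toB6 g R H)) (hrefl : ∀ y : g.Site, g.dist y y = 0) (hdnn : ∀ y y' : g.Site, 0 ≤ g.dist y y')
    (h261 : Ineq261 d (toB6 g R H) δ₀ α) (hsmall : θ * B6.c1 d δ₀ α < 1)
    {X GpU GpExt Wop : Module.End ℝ (W → ℝ)} (h365 : GpExt = GpU + GpExt * Wop)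
    (hX : HasL2Majorant (g := toB6 g R H) blk (X * GpU) (fun a b => A * P a * Real.exp (-(δ₀ * g.dist a b))))
    (hW : HasL2Majorant (g := toB6 g R H) blk Wop (fun a b => θ * Real.exp (-(δ₀ * g.dist a b)))) :
    HasL2Majorant (g := toB6 g R H) blk (X * GpExt)
      (fun a b => A * B6.c1 d δ₀ α * (1 - θ * B6.c1 d δ₀ α)⁻¹ * P a * Real.exp (-((1 - α) * δ₀ * g.dist a b))) := by
  have hαδ : 0 ≤ (1 - α) * δ₀ := mul_nonneg (by linarith) hδ₀
  have h263 := B6RandomWalk.ineq263_of_261 d (toB6 g R H) δ₀ α htri hδ₀ hα h261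
  have hfix : X * GpExt = X * GpU + X * GpExt * Wop := by
    conv_lhs => rw [h365]
    rw [mul_add, mul_assoc]
  exact B6RandomWalkL2Chain.l2Majorant_of_fixedPoint_266 (g := toB6 g R H) blk d δ₀ α θ A P hA hP hθ hαδ htri hrefl hdnn
    h261 h263 hsmall hX hW hfix

end Extension

end Literature.MathematicalPhysics.QuantumFieldTheory.Balaban1983to89.B9Ineq363L2
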